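import Literature.Computability.Complexity.TimeBoundsProofs
import Literature.Computability.Complexity.PaulPippengerSzemerediTrotter1983Segregators
import HarnessLib

/-!
# Time blocks and height blocks of a `TM2` run: its dependency graph is a multi-pushdown graph (PPST 1983, §2–3)

Literature / complexity toolkit, seventh brick of the inline formalization of
Paul–Pippenger–Szemerédi–Trotter 1983 (`PaulPippengerSzemerediTrotter1983.lean`, fact
`PaulEtAl1983_NTIME_not_subset_DTIME`; roadmap Layer 2). The four-alternation speed-up cuts a
deterministic run of `T` steps into `N = T / b` TIME BLOCKS and each stack into HEIGHT BLOCKS; a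
time block depends on the last time block that touched each height block it touches, and the
resulting dependency graph must be a multi-pushdown graph for the segregator theorem to apply
(Santhanam 2001, §1, p. 2, for tapes: "if the machine has `r` tapes, all the computation graphs
corresponding to it are in `H_{2r}`"). For Mathlib's multi-STACK machines (`Turing.FinTM2`) no
block-respecting transformation (Hopcroft–Paul–Valiant) is needed: the top of a stack moves by a
bounded amount per step, so in `b` steps a time block touches at most two adjacent height blocks
of size `β = b (P + Q) + P + Q + 1` (`P`, `Q` = pushes / pops per step), consecutive time blocks
share the boundary height, and `…Segregators.lean` (`isMultiPushdownGraph_walkEdges`) applies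
stack by stack.

* `TM2Comp.popBound` (pops AND peeks along a path: the pops per step, and the depth below the top
  a step can read), `machinePopBound`, `length_stepAux_ge`, `length_step_ge` — the twin of the
  tree's `pushBound` / `length_step_le` (`TimeBoundsProofs.lean`);
* `TM2Blocks.stepT` (the total step, stationary after halting), `run`, `height`,
  `height_succ_le`, `le_height_succ`, `height_le_of_le`, `le_height_of_le` (heights move by at most
  `P` up and `Q` down per step);
* `minH`, `maxH` (extreme boundary heights of a time block of length `b`), `maxH_le_minH_add`;
  `lo`, `hi` (the touched height blocks: `(minH - Q - bQ) / β … (maxH + P) / β`, with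
  `β = b (P + Q) + b Q + P + Q + 1`),
  **`isWalk_blocks`** (`IsWalk (lo …) (hi …) N` for `β = b (P + Q) + P + Q + 1`);
* `depEdges tm c₀ b N` — the successor edges and, for every stack, the last-toucher edges of its
  walk; **`isMultiPushdownGraph_depEdges`**: `IsMultiPushdownGraph (4 · |K|) N (depEdges …)`
  (`IsMultiPushdownGraph.mono_r`, union over the stacks).

No named fact is introduced (definitions with bodies and theorems only).

## References

* W. J. Paul, N. Pippenger, E. Szemerédi, W. T. Trotter, *On determinism versus non-determinism
  and related problems*, FOCS 1983, 429–438, §2–3 [PaulEtAl1983].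
* R. Santhanam, *On separators, segregators and time versus space*, CCC 2001, §1 (p. 2:
  computation graphs, block-respecting computations, `H_{2r}` for `r` tapes) [Santhanam2001].
* J. Hopcroft, W. Paul, L. Valiant, *On time versus space*, J. ACM 24 (1977) 332–337.
-/

namespace Literature.Computability.Complexity

open Turing Function

/-! ### Pops per step -/

namespace TM2Comp

section PopBound

variable {K : Type} {Γ : K → Type} {Λ σ : Type}

/-- The maximal number of `pop` and `peek` instructions along an execution path of a TM2
statement: a bound on the pops per step, and on the DEPTH below the initial top at which a step
can read a stack (each `pop` lowers the top by one, a `peek` reads the current top). [folklore] -/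
def popBound : TM2.Stmt Γ Λ σ → ℕ
  | TM2.Stmt.push _ _ q => popBound q
  | TM2.Stmt.peek _ _ q => popBound q + 1
  | TM2.Stmt.pop _ _ q => popBound q + 1
  | TM2.Stmt.load _ q => popBound q
  | TM2.Stmt.branch _ q₁ q₂ => max (popBound q₁) (popBound q₂)
  | TM2.Stmt.goto _ => 0
  | TM2.Stmt.halt => 0

variable [DecidableEq K]

/-- Executing one statement shortens each stack by at most `popBound` symbols. [folklore] -/
theorem length_stepAux_ge (q : TM2.Stmt Γ Λ σ) (v : σ) (S : ∀ k, List (Γ k)) (k : K) :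
    (S k).length ≤ ((TM2.stepAux q v S).stk k).length + popBound q := by
  induction q generalizing v S with
  | push k' f q ih =>
    simp only [TM2.stepAux, popBound]
    refine le_trans ?_ (ih _ _)
    have := length_update_cons_le S k' k (f v)
    rcases eq_or_ne k k' with rfl | h
    · simp
    · rw [update_of_ne h]
  | peek k' f q ih =>
    simp only [TM2.stepAux, popBound]
    exact (ih _ _).trans (Nat.le_succ _)
  | pop k' f q ih =>
    simp only [TM2.stepAux, popBound]
    refine le_trans ?_ (Nat.add_le_add_right (ih _ _) 1)
    rcases eq_or_ne k k' with rfl | h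
    · simp only [update_self, List.length_tail]; omega
    · rw [update_of_ne h]; omega
  | load f q ih => simp only [TM2.stepAux, popBound]; exact ih _ _
  | branch p q₁ q₂ ih₁ ih₂ =>
    simp only [TM2.stepAux, popBound]
    cases p v
    · refine (ih₂ v S).trans ?_
      simp only [cond_false]
      have := le_max_right (popBound q₁) (popBound q₂)
      omega
    · refine (ih₁ v S).trans ?_
      simp only [cond_true]
      have := le_max_left (popBound q₁) (popBound q₂)
      omega
  | goto l => simp [TM2.stepAux, popBound]
  | halt => simp [TM2.stepAux, popBound]

end PopBound

/-- A uniform bound on the number of pops and peeks performed by one step of a `FinTM2` (pops per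
step; read depth per step). [folklore] -/
noncomputable def machinePopBound (tm : FinTM2) : ℕ :=
  letI := tm.ΛFin
  Finset.univ.sup fun l => popBound (tm.m l)

/-- One step of a `FinTM2` shortens each stack by at most `machinePopBound` symbols. [folklore] -/
theorem length_step_ge (tm : FinTM2) (c d : tm.Cfg) (h : tm.step c = some d) (k : tm.K) :
    (c.stk k).length ≤ (d.stk k).length + machinePopBound tm := by
  letI := tm.ΛFin
  obtain ⟨_ | l, v, S⟩ := c
  · simp [FinTM2.step, TM2.step] at h
  · simp only [FinTM2.step, TM2.step] at h
    obtain rfl := Option.some.inj h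
    refine (length_stepAux_ge _ _ _ _).trans (Nat.add_le_add_left ?_ _)
    exact Finset.le_sup (f := fun l => popBound (tm.m l)) (Finset.mem_univ l)

end TM2Comp

/-! ### The total run and its heights -/

namespace TM2Blocks

variable (tm : FinTM2)

/-- The total step: Mathlib's partial step, stationary once the machine has halted. [folklore] -/
def stepT (c : tm.Cfg) : tm.Cfg := (tm.step c).getD c

/-- The run from `c₀`: the configuration after `t` total steps. [folklore] -/
def run (c₀ : tm.Cfg) (t : ℕ) : tm.Cfg := (stepT tm)^[t] c₀

/-- The height of stack `k` at time `t`. [folklore] -/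
def height (c₀ : tm.Cfg) (k : tm.K) (t : ℕ) : ℕ := ((run tm c₀ t).stk k).length

variable {tm}

/-- `run` at `t + 1`. [folklore] -/
theorem run_succ (c₀ : tm.Cfg) (t : ℕ) : run tm c₀ (t + 1) = stepT tm (run tm c₀ t) := by
  simp [run, Function.iterate_succ_apply']

/-- **Heights go up by at most `P` per step.** [folklore] -/
theorem height_succ_le (c₀ : tm.Cfg) (k : tm.K) (t : ℕ) :
    height tm c₀ k (t + 1) ≤ height tm c₀ k t + TM2Comp.machinePushBound tm := by
  unfold height
  rw [run_succ]
  unfold stepT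
  cases h : tm.step (run tm c₀ t) with
  | none => simp
  | some d => simpa using TM2Comp.length_step_le tm _ d h k

/-- **Heights go down by at most `Q` per step.** [folklore] -/
theorem le_height_succ (c₀ : tm.Cfg) (k : tm.K) (t : ℕ) :
    height tm c₀ k t ≤ height tm c₀ k (t + 1) + TM2Comp.machinePopBound tm := by
  unfold height
  rw [run_succ]
  unfold stepT
  cases h : tm.step (run tm c₀ t) with
  | none => simp
  | some d => simpa using TM2Comp.length_step_ge tm _ d h k

/-- Over `d` steps heights go up by at most `P d`. [folklore] -/
theorem height_le_of_le (c₀ : tm.Cfg) (k : tm.K) (t d : ℕ) :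
    height tm c₀ k (t + d) ≤ height tm c₀ k t + TM2Comp.machinePushBound tm * d := by
  induction d with
  | zero => simp
  | succ d ih =>
    have := height_succ_le c₀ k (t + d)
    rw [Nat.mul_succ, show t + (d + 1) = t + d + 1 from rfl]
    omega

/-- Over `d` steps heights go down by at most `Q d`. [folklore] -/
theorem le_height_of_le (c₀ : tm.Cfg) (k : tm.K) (t d : ℕ) :
    height tm c₀ k t ≤ height tm c₀ k (t + d) + TM2Comp.machinePopBound tm * d := by
  induction d with
  | zero => simp
  | succ d ih =>
    have := le_height_succ c₀ k (t + d)
    rw [Nat.mul_succ, show t + (d + 1) = t + d + 1 from rfl]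
    omega

/-! ### Time blocks: extreme boundary heights, touched height blocks -/

variable (tm)

/-- The minimal height of stack `k` at the step boundaries `j b, …, j b + b` of time block `j`.
[folklore] -/
noncomputable def minH (c₀ : tm.Cfg) (b : ℕ) (k : tm.K) (j : ℕ) : ℕ :=
  (Finset.range (b + 1)).inf' (by simp) fun d => height tm c₀ k (j * b + d)

/-- The maximal height of stack `k` at the step boundaries of time block `j`. [folklore] -/
noncomputable def maxH (c₀ : tm.Cfg) (b : ℕ) (k : tm.K) (j : ℕ) : ℕ :=
  (Finset.range (b + 1)).sup' (by simp) fun d => height tm c₀ k (j * b + d)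

/-- The height-block size: more than the spread of the heights accessed by one time block.
[folklore] -/
noncomputable def blockβ (b : ℕ) : ℕ :=
  b * (TM2Comp.machinePushBound tm + TM2Comp.machinePopBound tm) + b * TM2Comp.machinePopBound tm +
    TM2Comp.machinePushBound tm + TM2Comp.machinePopBound tm + 1

/-- The lowest height block possibly accessed by time block `j` on stack `k`, with a margin of
`b Q` more symbols (so that a re-simulation of the block from the contents above the cut has room
for `b` steps whatever it does: the static room check of `…Claims.lean`). [folklore] -/
noncomputable def lo (c₀ : tm.Cfg) (b : ℕ) (k : tm.K) (j : ℕ) : ℕ :=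
  (minH tm c₀ b k j - TM2Comp.machinePopBound tm - b * TM2Comp.machinePopBound tm) / blockβ tm b

/-- The highest height block possibly accessed by time block `j` on stack `k`. [folklore] -/
noncomputable def hi (c₀ : tm.Cfg) (b : ℕ) (k : tm.K) (j : ℕ) : ℕ :=
  (maxH tm c₀ b k j + TM2Comp.machinePushBound tm) / blockβ tm b

variable {tm}

/-- A boundary height lies between `minH` and `maxH`. [folklore] -/
theorem minH_le_height (c₀ : tm.Cfg) (b : ℕ) (k : tm.K) (j d : ℕ) (hd : d ≤ b) :
    minH tm c₀ b k j ≤ height tm c₀ k (j * b + d) :=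
  Finset.inf'_le _ (by simp; omega)

/-- A boundary height lies between `minH` and `maxH`. [folklore] -/
theorem height_le_maxH (c₀ : tm.Cfg) (b : ℕ) (k : tm.K) (j d : ℕ) (hd : d ≤ b) :
    height tm c₀ k (j * b + d) ≤ maxH tm c₀ b k j :=
  Finset.le_sup' (fun d => height tm c₀ k (j * b + d)) (by simp; omega)

/-- **The spread of a time block**: `maxH ≤ minH + b (P + Q)`. [folklore] -/
theorem maxH_le_minH_add (c₀ : tm.Cfg) (b : ℕ) (k : tm.K) (j : ℕ) :
    maxH tm c₀ b k j ≤ minH tm c₀ b k j +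
      b * (TM2Comp.machinePushBound tm + TM2Comp.machinePopBound tm) := by
  -- pick the argmax and the argmin
  obtain ⟨d₁, hd₁, h₁⟩ := Finset.exists_mem_eq_sup' (s := Finset.range (b + 1)) (by simp)
    (fun d => height tm c₀ k (j * b + d))
  obtain ⟨d₂, hd₂, h₂⟩ := Finset.exists_mem_eq_inf' (s := Finset.range (b + 1)) (by simp)
    (fun d => height tm c₀ k (j * b + d))
  unfold maxH minH
  rw [h₁, h₂]
  simp only [Finset.mem_range] at hd₁ hd₂
  rcases le_total d₁ d₂ with h | h
  · have := le_height_of_le c₀ k (j * b + d₁) (d₂ - d₁)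
    rw [show j * b + d₁ + (d₂ - d₁) = j * b + d₂ by omega] at this
    have hdd : d₂ - d₁ ≤ b := by omega
    have hm : TM2Comp.machinePopBound tm * (d₂ - d₁) ≤
        b * (TM2Comp.machinePushBound tm + TM2Comp.machinePopBound tm) :=
      (Nat.mul_le_mul_left _ hdd).trans (by rw [Nat.mul_comm, Nat.mul_add]; omega)
    omega
  · have := height_le_of_le c₀ k (j * b + d₂) (d₁ - d₂)
    rw [show j * b + d₂ + (d₁ - d₂) = j * b + d₁ by omega] at this
    have hdd : d₁ - d₂ ≤ b := by omega
    have hm : TM2Comp.machinePushBound tm * (d₁ - d₂) ≤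
        b * (TM2Comp.machinePushBound tm + TM2Comp.machinePopBound tm) :=
      (Nat.mul_le_mul_left _ hdd).trans (by rw [Nat.mul_comm, Nat.mul_add]; omega)
    omega

/-- **The touched height blocks of a run form a walk** (`…Segregators.lean`): at most two
adjacent height blocks per time block (the spread `b (P + Q) + b Q + P + Q` is below `β`), and consecutive
time blocks share the boundary height `height ((j+1) b)`. [cite: Santhanam2001, §1 (p. 2: block-respecting computation graphs)]
[cite: PaulEtAl1983, §3] -/
theorem isWalk_blocks (c₀ : tm.Cfg) (b : ℕ) (k : tm.K) (N : ℕ) :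
    IsWalk (lo tm c₀ b k) (hi tm c₀ b k) N := by
  have hβ : 0 < blockβ tm b := Nat.succ_pos _
  refine ⟨fun j => ?_, fun j => ?_, fun j _ => ?_⟩
  · unfold lo hi
    apply Nat.div_le_div_right
    have := minH_le_height c₀ b k j 0 (Nat.zero_le _)
    have := height_le_maxH c₀ b k j 0 (Nat.zero_le _)
    omega
  · unfold lo hi
    have hs := maxH_le_minH_add c₀ b k j
    -- `maxH + P < (minH - Q - b Q) + β`
    have hlt : maxH tm c₀ b k j + TM2Comp.machinePushBound tm <
        (minH tm c₀ b k j - TM2Comp.machinePopBound tm - b * TM2Comp.machinePopBound tm) +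
          blockβ tm b := by
      unfold blockβ; omega
    calc (maxH tm c₀ b k j + TM2Comp.machinePushBound tm) / blockβ tm b
        ≤ ((minH tm c₀ b k j - TM2Comp.machinePopBound tm - b * TM2Comp.machinePopBound tm) +
            blockβ tm b) / blockβ tm b :=
          Nat.div_le_div_right hlt.le
      _ = (minH tm c₀ b k j - TM2Comp.machinePopBound tm - b * TM2Comp.machinePopBound tm) /
            blockβ tm b + 1 :=
          Nat.add_div_right _ hβ
  · -- the shared boundary height
    unfold lo hi
    have h1 : minH tm c₀ b k (j + 1) ≤ height tm c₀ k ((j + 1) * b + 0) :=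
      minH_le_height c₀ b k (j + 1) 0 (Nat.zero_le _)
    have h2 : height tm c₀ k (j * b + b) ≤ maxH tm c₀ b k j := height_le_maxH c₀ b k j b le_rfl
    have h3 : minH tm c₀ b k j ≤ height tm c₀ k (j * b + b) := minH_le_height c₀ b k j b le_rfl
    have h4 : height tm c₀ k ((j + 1) * b + 0) ≤ maxH tm c₀ b k (j + 1) :=
      height_le_maxH c₀ b k (j + 1) 0 (Nat.zero_le _)
    rw [show (j + 1) * b + 0 = j * b + b by ring] at h1 h4
    constructor <;> apply Nat.div_le_div_right <;> omega

/-! ### The dependency graph of the run -/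

variable (tm)

open scoped Classical in
/-- **The dependency graph of the run** on `N` time blocks of length `b`: the successor edges
`j → j+1` (the finite control and the boundary heights carry over) and, for every stack, the
last-toucher edges of its walk (the content of a height block at the start of a time block is
its content at the end of the last time block that touched it).
[cite: Santhanam2001, §1 (p. 2, definition of the computation graph)] [cite: PaulEtAl1983, §3] -/
noncomputable def depEdges (c₀ : tm.Cfg) (b N : ℕ) : Finset (ℕ × ℕ) :=
  letI := tm.kFin
  ((Finset.range (N - 1)).image fun i => (i, i + 1)) ∪
    Finset.univ.biUnion fun k => walkEdges (lo tm c₀ b k) (hi tm c₀ b k) N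

variable {tm}

/-- Padding the families: `H_r(N) ⊆ H_{r'}(N)` for `r ≤ r'`. [folklore] -/
theorem _root_.Literature.Computability.Complexity.IsMultiPushdownGraph.mono_r {r r' N : ℕ}
    {E : Finset (ℕ × ℕ)} (h : IsMultiPushdownGraph r N E) (hr : r ≤ r') :
    IsMultiPushdownGraph r' N E := by
  obtain ⟨h1, F, hF, hcov⟩ := h
  refine ⟨h1, fun m => if hm : m.val < r then F ⟨m.val, hm⟩ else ∅, fun m => ?_, fun e he => ?_⟩
  · by_cases hm : m.val < r
    · simp only [hm, dite_true]; exact hF _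
    · simp only [hm, dite_false]; exact isPushdownFamily_empty
  · rcases hcov e he with h | ⟨m, hm⟩
    · exact Or.inl h
    · refine Or.inr ⟨⟨m.val, lt_of_lt_of_le m.isLt hr⟩, ?_⟩
      simp [m.isLt, hm]

/-- The union over a set of stacks of their walk graphs, with the successor edges, is in
`H_{4 |s|}(N)`. [folklore] -/
theorem isMultiPushdownGraph_biUnion (c₀ : tm.Cfg) (b N : ℕ) (s : Finset tm.K) :
    letI := tm.kDecidableEq
    IsMultiPushdownGraph (4 * s.card) N
      (((Finset.range (N - 1)).image fun i => (i, i + 1)) ∪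
        s.biUnion fun k => walkEdges (lo tm c₀ b k) (hi tm c₀ b k) N) := by
  letI := tm.kDecidableEq
  induction s using Finset.induction_on with
  | empty => simpa using isMultiPushdownGraph_succEdges N
  | insert k s hk ih =>
    have hk4 := isMultiPushdownGraph_walkEdges (isWalk_blocks c₀ b k N)
    have hu := isMultiPushdownGraph_union ih hk4
    rw [Finset.card_insert_of_notMem hk, Nat.mul_succ]
    refine (hu.mono_r le_rfl).subset ?_
    intro e he
    simp only [Finset.mem_union, Finset.mem_biUnion, Finset.mem_insert] at he ⊢
    rcases he with he | ⟨k', hk', he⟩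
    · exact Or.inl (Or.inl he)
    · rcases hk' with rfl | hk'
      · exact Or.inr he
      · exact Or.inl (Or.inr ⟨k', hk', he⟩)

/-- **The dependency graph of a `TM2` run is a multi-pushdown graph with `4 |K|` families** — the
stack version of "`r` tapes ⟹ `H_{2r}`" (Santhanam 2001, §1, p. 2), with no block-respecting
transformation: this is the hypothesis under which the segregator theorem of PPST 1983, §2 applies
to the run. [cite: Santhanam2001, §1 (p. 2)] [cite: PaulEtAl1983, §2–3] -/
theorem isMultiPushdownGraph_depEdges (c₀ : tm.Cfg) (b N : ℕ) :
    letI := tm.kFin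
    IsMultiPushdownGraph (4 * Fintype.card tm.K) N (depEdges tm c₀ b N) := by
  letI := tm.kFin
  letI := tm.kDecidableEq
  have := isMultiPushdownGraph_biUnion c₀ b N (Finset.univ : Finset tm.K)
  simpa [depEdges, Finset.card_univ] using this

end TM2Blocks

end Literature.Computability.Complexity
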